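import Literature.Probability.RandomPlanarGeometry.SLESameSideKernelLimits
import Literature.Probability.RandomPlanarGeometry.GaussIncompleteBeta
import Mathlib.MeasureTheory.Function.JacobianOneDim
import HarnessLib

/-!
# The same-side hitting probability in Rohde–Schramm's hypergeometric form (6.13)

Topic `Probability/RandomPlanarGeometry`; theorems only. For `1/4 < a < 1/2` (`a = 2/κ`,
`4 < κ < 8`) the hitting probability of Lawler's ratio on the branch `(1, ∞)`,
`(h(z₀) - h(1))/(h(∞) - h(1))` with `h = sameSideH a = ∫₂ K_a`, `K_a(t) = t^{-2a}(t-1)^{-2a}`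
(`SLESameSideKernel`, `SLESameSideKernelLimits`), read at `z₀ = s/(s-1)` (the ratio `x/(x-y)` for
`y = 1`, `x = s > 1`), is the right-hand side of S. Rohde, O. Schramm, *Basic properties of SLE*,
Ann. of Math. 161 (2005), eq. (6.13):

  `4^{1-2a} √π ₂F₁(1-2a, 2-4a; 2-2a; 1/s) s^{2a-1} / (Γ(2-2a) Γ(2a-1/2))`

(`sameSide_hittingProb_eq_rohdeSchramm613`), and this expression equals `1` at `s = 1`
(`rohdeSchramm613_at_one`, "is `1` when `s = 1`", p. 908). Steps:

* the change of variables `t = 1/(1-u)` (`u = 1 - 1/t ∈ (0, 1/s)`; Mathlib's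
  `integral_image_eq_integral_abs_deriv_smul`, no continuity needed at the singular endpoint):
  `∫_{(1, z₀)} K_a = ∫_{(0, 1/s)} u^{-2a}(1-u)^{4a-2} du` and `∫_{(1,∞)} K_a = ∫_{(0,1)}` of the same
  (`setIntegral_sameSideKernel_Ioo_eq`, `setIntegral_sameSideKernel_Ioi_eq`);
* Gauss's incomplete-beta identity and Euler's beta integral (`GaussIncompleteBeta`, parameters
  `α = 2-4a`, `β = 1-2a`, so `u^{β-1}(1-u)^{-α}` is the above integrand):
  `∫₀^{1/s} = s^{2a-1} ₂F₁(2-4a, 1-2a; 2-2a; 1/s)/(1-2a)`, `∫₀¹ = Γ(1-2a)Γ(4a-1)/Γ(2a)`;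
* the constants: `(1-2a)Γ(1-2a) = Γ(2-2a)`, Legendre's duplication
  `Γ(2a-1/2)Γ(2a) = 2^{2-4a} √π Γ(4a-1)` (Mathlib `Real.Gamma_mul_Gamma_add_half`), and the symmetry of
  `₂F₁` in its first two parameters.

## References

* S. Rohde, O. Schramm, *Basic properties of SLE*, Ann. of Math. 161 (2005), Lemma 6.6, eq. (6.13)
  and the remark after it ("zero when `s = ∞` and is `1` when `s = 1`").
* G. F. Lawler, *Conformally Invariant Processes in the Plane*, AMS (2005), Prop. 6.34.
-/

open Set Filter Topology MeasureTheory
open scoped Real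

noncomputable section

namespace Literature.Probability.RandomPlanarGeometry

variable {a : ℝ}

/-! ### The change of variables `t = 1/(1-u)` -/

/-- The image of `(0, r)` under `u ↦ 1/(1-u)` is `(1, 1/(1-r))` (`r < 1`). [folklore] -/
theorem image_inv_one_sub_Ioo {r : ℝ} (hr1 : r < 1) :
    (fun u : ℝ ↦ (1 - u)⁻¹) '' Ioo 0 r = Ioo 1 (1 - r)⁻¹ := by
  ext t
  simp only [mem_image, mem_Ioo]
  constructor
  · rintro ⟨u, ⟨hu0, hur⟩, rfl⟩
    have h1u : 0 < 1 - u := by linarith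
    refine ⟨(one_lt_inv₀ h1u).2 (by linarith), ?_⟩
    exact (inv_lt_inv₀ h1u (by linarith)).2 (by linarith)
  · rintro ⟨ht1, htr⟩
    have ht0 : 0 < t := lt_trans one_pos ht1
    refine ⟨1 - t⁻¹, ⟨by rw [sub_pos]; exact inv_lt_one_of_one_lt₀ ht1, ?_⟩, by simp⟩
    have h1r : 0 < 1 - r := by linarith
    have : t⁻¹ > 1 - r := by
      rw [gt_iff_lt, ← inv_inv (1 - r)]
      exact (inv_lt_inv₀ (inv_pos.2 h1r) ht0).2 htr
    linarith

/-- The image of `(0, 1)` under `u ↦ 1/(1-u)` is `(1, ∞)`. [folklore] -/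
theorem image_inv_one_sub_Ioo_one : (fun u : ℝ ↦ (1 - u)⁻¹) '' Ioo 0 1 = Ioi 1 := by
  ext t
  simp only [mem_image, mem_Ioo, mem_Ioi]
  constructor
  · rintro ⟨u, ⟨hu0, hu1⟩, rfl⟩
    exact (one_lt_inv₀ (by linarith)).2 (by linarith)
  · intro ht1
    have ht0 : 0 < t := lt_trans one_pos ht1
    exact ⟨1 - t⁻¹, ⟨by rw [sub_pos]; exact inv_lt_one_of_one_lt₀ ht1,
      by linarith [inv_pos.2 ht0]⟩, by simp⟩

/-- `u ↦ 1/(1-u)` has derivative `1/(1-u)²` (`u ≠ 1`). [folklore] -/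
theorem hasDerivAt_inv_one_sub {u : ℝ} (hu : u ≠ 1) :
    HasDerivAt (fun u : ℝ ↦ (1 - u)⁻¹) ((1 - u) ^ 2)⁻¹ u := by
  have h1 : (1 : ℝ) - u ≠ 0 := sub_ne_zero.2 (Ne.symm hu)
  have h := (hasDerivAt_inv h1).comp u ((hasDerivAt_id u).const_sub 1)
  have heq : -((1 - u) ^ 2)⁻¹ * -1 = ((1 - u) ^ 2)⁻¹ := by ring
  rw [heq] at h
  exact h

/-- `u ↦ 1/(1-u)` is injective on `(0, 1)`. [folklore] -/
theorem injOn_inv_one_sub : InjOn (fun u : ℝ ↦ (1 - u)⁻¹) (Ioo 0 1) := by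
  intro u hu v hv h
  have h' : (1 - u : ℝ) = 1 - v := inv_injective h
  linarith

/-- **The kernel under the change of variables**: for `u ∈ (0, 1)`,
`(1-u)^{-2} K_a(1/(1-u)) = u^{-2a}(1-u)^{4a-2} = u^{(1-2a)-1}(1-u)^{-(2-4a)}`. [folklore] -/
theorem sameSideKernel_inv_one_sub (a : ℝ) {u : ℝ} (hu : u ∈ Ioo (0 : ℝ) 1) :
    ((1 - u) ^ 2)⁻¹ * sameSideKernel a (1 - u)⁻¹ = u ^ (1 - 2 * a - 1) * (1 - u) ^ (-(2 - 4 * a)) := by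
  have hu0 : 0 < u := hu.1
  have h1u : 0 < 1 - u := by linarith [hu.2]
  have hsub : (1 - u)⁻¹ - 1 = u * (1 - u)⁻¹ := by field_simp; ring
  rw [sameSideKernel, hsub, Real.mul_rpow hu0.le (inv_nonneg.2 h1u.le), Real.inv_rpow h1u.le,
    ← Real.rpow_neg h1u.le, neg_neg]
  have hsq : ((1 - u) ^ 2)⁻¹ = (1 - u) ^ (-2 : ℝ) := by
    rw [Real.rpow_neg h1u.le, Real.rpow_two]
  rw [hsq, show (1 - 2 * a - 1 : ℝ) = -(2 * a) by ring]
  have hcomb : (1 - u) ^ (-2 : ℝ) * ((1 - u) ^ (2 * a) * (1 - u) ^ (2 * a)) = (1 - u) ^ (-(2 - 4 * a)) := by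
    rw [← Real.rpow_add h1u, ← Real.rpow_add h1u]
    congr 1; ring
  calc (1 - u) ^ (-2 : ℝ) * ((1 - u) ^ (2 * a) * (u ^ (-(2 * a)) * (1 - u) ^ (2 * a)))
        = u ^ (-(2 * a)) * ((1 - u) ^ (-2 : ℝ) * ((1 - u) ^ (2 * a) * (1 - u) ^ (2 * a))) := by ring
    _ = u ^ (-(2 * a)) * (1 - u) ^ (-(2 - 4 * a)) := by rw [hcomb]

/-- **`∫_{(1, 1/(1-r))} K_a = ∫_{(0, r)} u^{-2a}(1-u)^{4a-2} du`** for `0 < r < 1` (change of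
variables `t = 1/(1-u)`). [folklore] -/
theorem setIntegral_sameSideKernel_Ioo_eq (a : ℝ) {r : ℝ} (hr1 : r < 1) :
    ∫ t in Ioo 1 (1 - r)⁻¹, sameSideKernel a t =
      ∫ u in Ioo 0 r, u ^ (1 - 2 * a - 1) * (1 - u) ^ (-(2 - 4 * a)) := by
  rw [← image_inv_one_sub_Ioo hr1,
    integral_image_eq_integral_abs_deriv_smul measurableSet_Ioo
      (fun u hu ↦ (hasDerivAt_inv_one_sub (by linarith [hu.2] : u ≠ 1)).hasDerivWithinAt)
      (injOn_inv_one_sub.mono (Ioo_subset_Ioo_right hr1.le))]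
  refine setIntegral_congr_fun measurableSet_Ioo fun u hu ↦ ?_
  have hu' : u ∈ Ioo (0 : ℝ) 1 := ⟨hu.1, hu.2.trans hr1⟩
  rw [abs_of_pos (inv_pos.2 (pow_pos (by linarith [hu'.2]) 2)), smul_eq_mul]
  exact sameSideKernel_inv_one_sub a hu'

/-- **`∫_{(1, ∞)} K_a = ∫_{(0, 1)} u^{-2a}(1-u)^{4a-2} du`** (change of variables `t = 1/(1-u)`).
[folklore] -/
theorem setIntegral_sameSideKernel_Ioi_eq (a : ℝ) :
    ∫ t in Ioi 1, sameSideKernel a t = ∫ u in Ioo 0 1, u ^ (1 - 2 * a - 1) * (1 - u) ^ (-(2 - 4 * a)) := by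
  rw [← image_inv_one_sub_Ioo_one,
    integral_image_eq_integral_abs_deriv_smul measurableSet_Ioo
      (fun u hu ↦ (hasDerivAt_inv_one_sub (by linarith [hu.2] : u ≠ 1)).hasDerivWithinAt)
      injOn_inv_one_sub]
  refine setIntegral_congr_fun measurableSet_Ioo fun u hu ↦ ?_
  rw [abs_of_pos (inv_pos.2 (pow_pos (by linarith [hu.2]) 2)), smul_eq_mul]
  exact sameSideKernel_inv_one_sub a hu

/-! ### `h(z₀) - h(1)` and `h(∞) - h(1)` in closed form -/

/-- **`h(s/(s-1)) - h(1) = s^{2a-1} ₂F₁(2-4a, 1-2a; 2-2a; 1/s)/(1-2a)`** for `1/4 < a < 1/2`, `s > 1`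
(`h = sameSideH a`): `∫₁^{z₀} K_a = ∫₀^{1/s} u^{-2a}(1-u)^{4a-2} du` and Gauss's incomplete-beta
identity (`rpow_mul_hypergeometric_eq_integral`, `(1/s)^{1-2a} = s^{2a-1}`).
[cite: RohdeSchramm2005, eq. (6.13)] -/
theorem sameSideH_sub_one_eq_hypergeometric (ha : 1 / 4 < a) (ha' : a < 1 / 2) {s : ℝ} (hs : 1 < s) :
    sameSideH a (s / (s - 1)) - sameSideH a 1 =
      s ^ (2 * a - 1) * ₂F₁ (2 - 4 * a) (1 - 2 * a) (2 - 2 * a) (1 / s) / (1 - 2 * a) := by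
  have hs0 : 0 < s := lt_trans one_pos hs
  have hr0 : 0 < 1 / s := by positivity
  have hr1 : 1 / s < 1 := (div_lt_one hs0).2 hs
  have hz₀ : (1 - 1 / s)⁻¹ = s / (s - 1) := by
    field_simp
  have hz₀1 : 1 < s / (s - 1) := by rw [one_lt_div (by linarith)]; linarith
  have hα : 0 < 2 - 4 * a := by linarith
  have hβ : 0 < 1 - 2 * a := by linarith
  -- `h(z₀) - h(1) = ∫_{(1, z₀)} K_a = ∫₀^{1/s} betaKernel`
  rw [sameSideH_sub_one ha' hz₀1.le, intervalIntegral.integral_of_le hz₀1.le,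
    integral_Ioc_eq_integral_Ioo, ← hz₀, setIntegral_sameSideKernel_Ioo_eq a hr1,
    ← integral_Ioc_eq_integral_Ioo, ← intervalIntegral.integral_of_le hr0.le]
  -- Gauss
  have hG := rpow_mul_hypergeometric_eq_integral hα hβ (z := 1 / s) ⟨hr0.le, hr1⟩
  rw [show (1 - 2 * a + 1 : ℝ) = 2 - 2 * a by ring] at hG
  rw [eq_div_iff hβ.ne', mul_comm _ (1 - 2 * a), ← hG, one_div, Real.inv_rpow hs0.le,
    ← Real.rpow_neg hs0.le, neg_sub]

/-- **`h(∞) - h(1) = Γ(1-2a)Γ(4a-1)/Γ(2a)`** for `1/4 < a < 1/2` (`∫_{(1,∞)} K_a = Β(1-2a, 4a-1)`,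
Euler's beta integral `integral_betaKernel_eq_Gamma`). [cite: RohdeSchramm2005, eq. (6.13)] -/
theorem sameSideHTop_sub_one_eq_Gamma (ha : 1 / 4 < a) (ha' : a < 1 / 2) :
    sameSideHTop a - sameSideH a 1 = Real.Gamma (1 - 2 * a) * Real.Gamma (4 * a - 1) / Real.Gamma (2 * a) := by
  have hα1 : 2 - 4 * a < 1 := by linarith
  have hβ : 0 < 1 - 2 * a := by linarith
  rw [sameSideHTop_sub_sameSideH_one ha ha', setIntegral_sameSideKernel_Ioi_eq a,
    ← integral_Ioc_eq_integral_Ioo, ← intervalIntegral.integral_of_le zero_le_one,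
    integral_betaKernel_eq_Gamma hα1 hβ]
  congr 2 <;> ring_nf

/-! ### Rohde–Schramm's (6.13) -/

/-- Legendre's duplication at `2a - 1/2`: `Γ(2a)/Γ(4a-1) = 4^{1-2a} √π / Γ(2a-1/2)` (`a > 1/4`).
[folklore] -/
theorem Gamma_two_mul_div_eq (ha : 1 / 4 < a) :
    Real.Gamma (2 * a) / Real.Gamma (4 * a - 1) =
      (4 : ℝ) ^ (1 - 2 * a) * Real.sqrt π / Real.Gamma (2 * a - 1 / 2) := by
  have h := Real.Gamma_mul_Gamma_add_half (2 * a - 1 / 2)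
  rw [show (2 * a - 1 / 2 + 1 / 2 : ℝ) = 2 * a by ring,
    show (1 - 2 * (2 * a - 1 / 2) : ℝ) = 2 * (1 - 2 * a) by ring,
    show (2 * (2 * a - 1 / 2) : ℝ) = 4 * a - 1 by ring] at h
  have h4 : (2 : ℝ) ^ (2 * (1 - 2 * a)) = (4 : ℝ) ^ (1 - 2 * a) := by
    rw [Real.rpow_mul zero_le_two, Real.rpow_two]; norm_num
  rw [h4] at h
  have hG1 : Real.Gamma (2 * a - 1 / 2) ≠ 0 := (Real.Gamma_pos_of_pos (by linarith)).ne'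
  have hG2 : Real.Gamma (4 * a - 1) ≠ 0 := (Real.Gamma_pos_of_pos (by linarith)).ne'
  rw [div_eq_div_iff hG2 hG1]
  linarith [h]

/-- **The same-side hitting probability is Rohde–Schramm's (6.13).** For `1/4 < a < 1/2` and
`s > 1`, with `h = sameSideH a`:
`(h(s/(s-1)) - h(1))/(h(∞) - h(1)) = 4^{1-2a} √π ₂F₁(1-2a, 2-4a; 2-2a; 1/s) s^{2a-1}/(Γ(2-2a)Γ(2a-1/2))`
— with `a = 2/κ` this is the right-hand side of (6.13), `1 - 2a = 1 - 4/κ = (κ-4)/κ`,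
`2 - 4a = 2 - 8/κ`, `2 - 2a = 2 - 4/κ`, `2a - 1 = (4-κ)/κ`, `2a - 1/2 = 4/κ - 1/2`.
[cite: RohdeSchramm2005, Lemma 6.6, eq. (6.13)] -/
theorem sameSide_hittingProb_eq_rohdeSchramm613 (ha : 1 / 4 < a) (ha' : a < 1 / 2) {s : ℝ} (hs : 1 < s) :
    (sameSideH a (s / (s - 1)) - sameSideH a 1) / (sameSideHTop a - sameSideH a 1) =
      (4 : ℝ) ^ (1 - 2 * a) * Real.sqrt π *
          ₂F₁ (1 - 2 * a) (2 - 4 * a) (2 - 2 * a) (1 / s) * s ^ (2 * a - 1) /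
        (Real.Gamma (2 - 2 * a) * Real.Gamma (2 * a - 1 / 2)) := by
  have hβ : 0 < 1 - 2 * a := by linarith
  have hG1 : Real.Gamma (1 - 2 * a) ≠ 0 := (Real.Gamma_pos_of_pos hβ).ne'
  have hG2 : Real.Gamma (4 * a - 1) ≠ 0 := (Real.Gamma_pos_of_pos (by linarith)).ne'
  have hG3 : Real.Gamma (2 * a) ≠ 0 := (Real.Gamma_pos_of_pos (by linarith)).ne'
  have hG4 : Real.Gamma (2 * a - 1 / 2) ≠ 0 := (Real.Gamma_pos_of_pos (by linarith)).ne'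
  have hG5 : Real.Gamma (2 - 2 * a) ≠ 0 := (Real.Gamma_pos_of_pos (by linarith)).ne'
  have hΓ : Real.Gamma (2 - 2 * a) = (1 - 2 * a) * Real.Gamma (1 - 2 * a) := by
    rw [show (2 - 2 * a : ℝ) = (1 - 2 * a) + 1 by ring, Real.Gamma_add_one hβ.ne']
  -- symmetry of `₂F₁` in its first two parameters
  have hsymm : ₂F₁ (1 - 2 * a) (2 - 4 * a) (2 - 2 * a) (1 / s) =
      ₂F₁ (2 - 4 * a) (1 - 2 * a) (2 - 2 * a) (1 / s) := by
    simp only [ordinaryHypergeometric, ordinaryHypergeometricSeries_symm]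
  rw [sameSideH_sub_one_eq_hypergeometric ha ha' hs, sameSideHTop_sub_one_eq_Gamma ha ha', hsymm]
  have hdup := Gamma_two_mul_div_eq ha
  rw [div_eq_div_iff hG2 hG4] at hdup
  rw [hΓ]
  have hs0 : 0 < s := lt_trans one_pos hs
  have hP : s ^ (2 * a - 1) ≠ 0 := (Real.rpow_pos_of_pos hs0 _).ne'
  -- freeze the transcendental atoms before clearing denominators
  set F := ₂F₁ (2 - 4 * a) (1 - 2 * a) (2 - 2 * a) (1 / s) with hF
  set P := s ^ (2 * a - 1) with hPdef
  set Q := (4 : ℝ) ^ (1 - 2 * a) with hQ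
  set G₁ := Real.Gamma (1 - 2 * a) with hG₁
  set G₂ := Real.Gamma (4 * a - 1) with hG₂
  set G₃ := Real.Gamma (2 * a) with hG₃
  set G₄ := Real.Gamma (2 * a - 1 / 2) with hG₄
  have hβ0 : (1 - 2 * a : ℝ) ≠ 0 := hβ.ne'
  field_simp
  linear_combination F * hdup

/-- **(6.13) is `1` at `s = 1`** ("is `1` when `s = 1`", p. 908): for `1/4 < a < 1/2`,
`4^{1-2a} √π ₂F₁(1-2a, 2-4a; 2-2a; 1) / (Γ(2-2a)Γ(2a-1/2)) = 1`, by Gauss's summation theorem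
`₂F₁(2-4a, 1-2a; 2-2a; 1) = Γ(2-2a)Γ(4a-1)/Γ(2a)` (`hypergeometric_one_eq_Gamma`) and the
duplication formula. [cite: RohdeSchramm2005, Lemma 6.6, eq. (6.13)] -/
theorem rohdeSchramm613_at_one (ha : 1 / 4 < a) (ha' : a < 1 / 2) :
    (4 : ℝ) ^ (1 - 2 * a) * Real.sqrt π *
          ₂F₁ (1 - 2 * a) (2 - 4 * a) (2 - 2 * a) (1 / (1 : ℝ)) * (1 : ℝ) ^ (2 * a - 1) /
        (Real.Gamma (2 - 2 * a) * Real.Gamma (2 * a - 1 / 2)) = 1 := by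
  have hα : 0 < 2 - 4 * a := by linarith
  have hα1 : 2 - 4 * a < 1 := by linarith
  have hβ : 0 < 1 - 2 * a := by linarith
  have hG2 : Real.Gamma (4 * a - 1) ≠ 0 := (Real.Gamma_pos_of_pos (by linarith)).ne'
  have hG3 : Real.Gamma (2 * a) ≠ 0 := (Real.Gamma_pos_of_pos (by linarith)).ne'
  have hG4 : Real.Gamma (2 * a - 1 / 2) ≠ 0 := (Real.Gamma_pos_of_pos (by linarith)).ne'
  have hG5 : Real.Gamma (2 - 2 * a) ≠ 0 := (Real.Gamma_pos_of_pos (by linarith)).ne'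
  have hsymm : ₂F₁ (1 - 2 * a) (2 - 4 * a) (2 - 2 * a) (1 : ℝ) =
      ₂F₁ (2 - 4 * a) (1 - 2 * a) (2 - 2 * a) (1 : ℝ) := by
    simp only [ordinaryHypergeometric, ordinaryHypergeometricSeries_symm]
  have hGauss := hypergeometric_one_eq_Gamma hα hα1 hβ
  rw [show (1 - 2 * a + 1 : ℝ) = 2 - 2 * a by ring, show (1 - (2 - 4 * a) : ℝ) = 4 * a - 1 by ring,
    show (2 - 2 * a - (2 - 4 * a) : ℝ) = 2 * a by ring] at hGauss
  have hdup := Gamma_two_mul_div_eq ha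
  rw [div_eq_div_iff hG2 hG4] at hdup
  rw [div_one, Real.one_rpow, mul_one, hsymm, hGauss]
  -- freeze the transcendental atoms before clearing denominators
  set Q := (4 : ℝ) ^ (1 - 2 * a) with hQ
  set G₁ := Real.Gamma (2 - 2 * a) with hG₁
  set G₂ := Real.Gamma (4 * a - 1) with hG₂
  set G₃ := Real.Gamma (2 * a) with hG₃
  set G₄ := Real.Gamma (2 * a - 1 / 2) with hG₄
  field_simp
  linear_combination (-1 : ℝ) * hdup

end Literature.Probability.RandomPlanarGeometry
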